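import Mathlib.Analysis.SpecialFunctions.Pow.Asymptotics
import Mathlib.Analysis.SpecialFunctions.Pow.Real
import HarnessLib

/-!
# Functional mining for 3D Navier–Stokes: the scaling sieve and the parity–amplitude sieve

Search for candidate a priori estimates; no regularity claim.

Cell `pub-nsfunc` (host summit NavierStokesRegularity, topic `FunctionalMining`). Two elementary
sieves decide whole classes of census rows "`dF/dt ≤ C·G` along every smooth solution" WITHOUT
computation; this file proves their real-variable cores (kernel-checked), the dynamic reduction
being the documented hypothesis.

Reduction (paper `papers/NavierStokesRegularity/functional-mining/estimates.tex`, §2). If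
`dF/dt ≤ C·G` holds along every smooth solution of Navier–Stokes with viscosity `ν`, then by local
smooth solubility from smooth data and the balance identity at the initial time,
`N_F(u₀) + ν V_F(u₀) ≤ C·G(u₀)` for EVERY smooth divergence-free datum `u₀`, where
`N_F(u) = DF(u)[−P(u·∇)u]` is the inertial (Euler) rate of `F` and `V_F(u) = DF(u)[Δu]` its
viscous rate (on `T³` both inputs are in the tree: `TorusNSSmoothLocalExistence`,
`Torus.IsClassicalNSSolutionOn.hasDerivWithinAt_half_gradNormSq`).

* SIEVE 1 (space-time scaling `u_λ(x,t) = λu(λx, λ²t)`, `ν` fixed). For `F`, `G` homogeneous of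
  degrees `s_F`, `s_G` and one datum with positive total rate `a` and `b = C·G(u₀) > 0`, the
  dilated data give `a λ^{s_F+2} ≤ b λ^{s_G}`: for all integers `λ = n ≥ 1` on `T³` (a shrinking
  bump in one cell), for all `λ > 0` on `ℝ³`. `exponent_le_of_forall_nat_mul_rpow_le`: then
  `s_F + 2 ≤ s_G`; `exponent_eq_of_forall_mul_rpow_le`: then `s_G = s_F + 2` — a universal budget
  sits on the critical line, one unit of scaling above the Grönwall-closable degree `s_F + 1`.
* SIEVE 2 (amplitude `u ↦ A u` and time-reversal parity `u ↦ −u`). If `F` is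
  amplitude-homogeneous of degree `k` then `N_F(Au) = A^{k+1}N_F(u)`, `V_F(Au) = A^k V_F(u)`; the
  Euler nonlinearity is even and the Laplacian odd, so the inertial rate of an even functional is
  odd and its viscous rate even. `coeff_nonpos_of_forall_mul_pow_succ_add_le` (core),
  `amplitude_sieve` (`N + νV ≤ 0` everywhere ⇒ `N ≤ 0` and `V ≤ 0` separately),
  `parity_amplitude_sieve` (`|Nₑ| ≤ −Nₒ`, `|Vₒ| ≤ −Vₑ` for the even/odd parts),
  `even_monotone_is_euler_invariant` (an even homogeneous functional that is non-increasing along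
  every solution has `N ≡ 0` — it is a formal Euler invariant — and `V ≤ 0`). Consequence for the
  census: among even homogeneous dictionary entries (enstrophy, `L^p` norms of vorticity or
  strain, palinstrophy, evenly weighted enstrophies) none but formal Euler invariants can be
  monotone; the kinetic energy is and survives (`FunctionalMining/RateBudgets.lean`).
* (appended) the same Sieve 2 lemmas with a REAL amplitude degree (`Real.rpow`):
  `coeff_nonpos_of_forall_mul_rpow_add_one_add_le`, `amplitude_sieve_rpow`,
  `parity_amplitude_sieve_rpow`, `even_monotone_is_euler_invariant_rpow` — for the dictionary's
  candidates of non-integer degree (`∫|ω|^{3/2}`, …).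

Deliberately NOT here: the dynamic reduction itself as a Lean theorem (needs the derivative of a
general functional along the flow), witness data, and any statement about a specific candidate.
-/

noncomputable section

open Filter
open scoped Topology

namespace Summit.NavierStokesRegularity.FunctionalMining

/-! ## Sieve 1: space-time scaling forces the critical line -/

/-- **Scaling sieve, one-sided (integer dilations, the torus case).** If `a > 0` and
`a · n^p ≤ b · n^q` for every integer `n ≥ 1`, then `p ≤ q`. Use: a universal budget
`dF/dt ≤ C·G` between Navier–Stokes-homogeneous quantities of degrees `s_F`, `s_G`, evaluated on
the dilates `u₀⁽ⁿ⁾(x) = n u₀(n x)` of one datum with positive total rate `a = N_F(u₀) + νV_F(u₀)`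
and `b = C·G(u₀)`, reads `a n^{s_F+2} ≤ b n^{s_G}`; hence `s_G ≥ s_F + 2`. [folklore] -/
theorem exponent_le_of_forall_nat_mul_rpow_le {a b p q : ℝ} (ha : 0 < a)
    (h : ∀ n : ℕ, 1 ≤ n → a * (n : ℝ) ^ p ≤ b * (n : ℝ) ^ q) : p ≤ q := by
  by_contra hlt
  have hpq : 0 < p - q := sub_pos.2 (not_le.mp hlt)
  -- `a n^{p-q} ≤ b` for all `n ≥ 1`
  have hbound : ∀ n : ℕ, 1 ≤ n → a * (n : ℝ) ^ (p - q) ≤ b := by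
    intro n hn
    have hn0 : (0 : ℝ) < n := by exact_mod_cast hn
    have hq0 : 0 < (n : ℝ) ^ q := Real.rpow_pos_of_pos hn0 q
    rw [Real.rpow_sub hn0, mul_div_assoc', div_le_iff₀ hq0]
    exact h n hn
  -- but `n^{p-q} → ∞`
  have htend : Tendsto (fun n : ℕ => a * (n : ℝ) ^ (p - q)) atTop atTop :=
    Tendsto.const_mul_atTop ha ((tendsto_rpow_atTop hpq).comp tendsto_natCast_atTop_atTop)
  obtain ⟨N, hN⟩ := (htend.eventually_gt_atTop b).and (eventually_ge_atTop 1) |>.exists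
  exact absurd (hbound N hN.2) (not_le.2 hN.1)

/-- **Scaling sieve, two-sided (all positive dilations, the whole-space case).** If `a > 0` and
`a · x^p ≤ b · x^q` for every real `x > 0`, then `p = q`: the budget sits on the critical line
`s_G = s_F + 2`. (`x → ∞` gives `p ≤ q`; `x = 1/n` gives `q ≤ p`.) [folklore] -/
theorem exponent_eq_of_forall_mul_rpow_le {a b p q : ℝ} (ha : 0 < a)
    (h : ∀ x : ℝ, 0 < x → a * x ^ p ≤ b * x ^ q) : p = q := by
  have h₁ : p ≤ q := exponent_le_of_forall_nat_mul_rpow_le ha fun n hn =>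
    h n (by exact_mod_cast hn)
  have h₂ : -p ≤ -q := by
    refine exponent_le_of_forall_nat_mul_rpow_le (b := b) ha fun n hn => ?_
    have hn0 : (0 : ℝ) < n := by exact_mod_cast hn
    have := h ((n : ℝ)⁻¹) (inv_pos.2 hn0)
    rwa [Real.inv_rpow hn0.le, Real.inv_rpow hn0.le, ← Real.rpow_neg hn0.le,
      ← Real.rpow_neg hn0.le] at this
  linarith

/-! ## Sieve 2: amplitude scaling and time-reversal parity -/

/-- Core of the amplitude sieve: if `c₁ A^{k+1} + c₂ A^k ≤ 0` for all `A > 0` then `c₁ ≤ 0` and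
`c₂ ≤ 0` (divide by `A^k` and let `A → ∞`, `A → 0`). [folklore] -/
theorem coeff_nonpos_of_forall_mul_pow_succ_add_le {c₁ c₂ : ℝ} {k : ℕ}
    (h : ∀ A : ℝ, 0 < A → c₁ * A ^ (k + 1) + c₂ * A ^ k ≤ 0) : c₁ ≤ 0 ∧ c₂ ≤ 0 := by
  have hlin : ∀ A : ℝ, 0 < A → c₁ * A + c₂ ≤ 0 := by
    intro A hA
    have hk : 0 < A ^ k := pow_pos hA k
    have hA' := h A hA
    have hfac : c₁ * A ^ (k + 1) + c₂ * A ^ k = A ^ k * (c₁ * A + c₂) := by ring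
    rw [hfac] at hA'
    by_contra hcon
    have := mul_pos hk (not_le.mp hcon)
    linarith
  constructor
  · by_contra hc
    have hc' : 0 < c₁ := not_le.mp hc
    have := hlin ((|c₂| + 1) / c₁) (by positivity)
    rw [mul_div_cancel₀ _ hc'.ne'] at this
    linarith [neg_abs_le c₂]
  · by_contra hc
    have hc' : 0 < c₂ := not_le.mp hc
    have hA : 0 < c₂ / (2 * (|c₁| + 1)) := by positivity
    have := hlin _ hA
    have hc₁ : -|c₁| * (c₂ / (2 * (|c₁| + 1))) ≤ c₁ * (c₂ / (2 * (|c₁| + 1))) :=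
      mul_le_mul_of_nonneg_right (neg_abs_le c₁) hA.le
    have hkey : |c₁| * (c₂ / (2 * (|c₁| + 1))) < c₂ := by
      rw [mul_div_assoc', div_lt_iff₀ (by positivity)]
      nlinarith [abs_nonneg c₁]
    linarith

/-- **Amplitude sieve.** On a real vector space of "fields", let `N` (inertial rate of a
functional `F`) scale like `A^{k+1}` and `V` (viscous rate) like `A^k` under `u ↦ A u`, `A > 0`
(`F` amplitude-homogeneous of degree `k`). If the total rate `N u + ν V u` is `≤ 0` for EVERY
`u` — the necessary condition for `F` to be non-increasing along every solution — then
`N ≤ 0` and `V ≤ 0` separately, everywhere. [folklore] -/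
theorem amplitude_sieve {X : Type*} [AddCommGroup X] [Module ℝ X] (N V : X → ℝ) (k : ℕ)
    {ν : ℝ} (hν : 0 < ν)
    (hN : ∀ A : ℝ, 0 < A → ∀ u, N (A • u) = A ^ (k + 1) * N u)
    (hV : ∀ A : ℝ, 0 < A → ∀ u, V (A • u) = A ^ k * V u)
    (h : ∀ u, N u + ν * V u ≤ 0) : (∀ u, N u ≤ 0) ∧ ∀ u, V u ≤ 0 := by
  have key : ∀ u, N u ≤ 0 ∧ ν * V u ≤ 0 := by
    intro u
    refine coeff_nonpos_of_forall_mul_pow_succ_add_le (k := k) fun A hA => ?_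
    have := h (A • u)
    rw [hN A hA u, hV A hA u] at this
    linarith
  refine ⟨fun u => (key u).1, fun u => ?_⟩
  by_contra hc
  have := mul_pos hν (not_le.mp hc)
  linarith [(key u).2]

/-- **Parity–amplitude sieve.** Split the rates of an amplitude-homogeneous functional
`F = F_e + F_o` (even + odd parts under `u ↦ −u`) as `N = Nₑ + Nₒ`, `V = Vₑ + Vₒ`, where — the
Euler nonlinearity being even and the Laplacian odd — `Nₑ` (inertial rate of the even part) is
ODD, `Nₒ` is even, `Vₑ` is even and `Vₒ` (viscous rate of the odd part) is odd. If the total rate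
is `≤ 0` for every field then `|Nₑ u| ≤ −Nₒ u` and `|Vₒ u| ≤ −Vₑ u` for every `u`. In particular
for an EVEN functional (`Nₒ = Vₒ = 0`): `Nₑ ≡ 0` — `F` must be a formal invariant of the Euler
dynamics — and `Vₑ ≤ 0`; for an ODD one: `Vₒ ≡ 0` and `Nₒ ≤ 0`. This decides the monotonicity
column of the census for every even homogeneous dictionary entry (enstrophy, `L^p` norms of the
vorticity or the strain, palinstrophy, evenly weighted enstrophies: none is an Euler invariant, so
none is monotone; the kinetic energy is, and survives). [folklore] -/
theorem parity_amplitude_sieve {X : Type*} [AddCommGroup X] [Module ℝ X]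
    (Ne No Ve Vo : X → ℝ) (k : ℕ) {ν : ℝ} (hν : 0 < ν)
    (hNe : ∀ A : ℝ, 0 < A → ∀ u, Ne (A • u) = A ^ (k + 1) * Ne u)
    (hNo : ∀ A : ℝ, 0 < A → ∀ u, No (A • u) = A ^ (k + 1) * No u)
    (hVe : ∀ A : ℝ, 0 < A → ∀ u, Ve (A • u) = A ^ k * Ve u)
    (hVo : ∀ A : ℝ, 0 < A → ∀ u, Vo (A • u) = A ^ k * Vo u)
    (hNe_odd : ∀ u, Ne (-u) = -Ne u) (hNo_even : ∀ u, No (-u) = No u)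
    (hVe_even : ∀ u, Ve (-u) = Ve u) (hVo_odd : ∀ u, Vo (-u) = -Vo u)
    (h : ∀ u, Ne u + No u + ν * (Ve u + Vo u) ≤ 0) :
    ∀ u, |Ne u| ≤ -No u ∧ |Vo u| ≤ -Ve u := by
  have hs := amplitude_sieve (fun u => Ne u + No u) (fun u => Ve u + Vo u) k hν
    (fun A hA u => by simp only [hNe A hA u, hNo A hA u]; ring)
    (fun A hA u => by simp only [hVe A hA u, hVo A hA u]; ring)
    (fun u => by simpa [mul_add, add_assoc] using h u)
  intro u
  have h1 := hs.1 u
  have h2 := hs.1 (-u)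
  have h3 := hs.2 u
  have h4 := hs.2 (-u)
  simp only [hNe_odd, hNo_even, hVe_even, hVo_odd] at h2 h4
  constructor <;> rw [abs_le] <;> constructor <;> linarith

/-- **Even functionals: monotone ⇒ Euler-invariant.** The special case `F` even of
`parity_amplitude_sieve`: if the inertial rate `N` is odd and scales like `A^{k+1}`, the viscous
rate `V` is even and scales like `A^k`, and `N + νV ≤ 0` everywhere, then `N ≡ 0` and `V ≤ 0`.
[folklore] -/
theorem even_monotone_is_euler_invariant {X : Type*} [AddCommGroup X] [Module ℝ X]
    (N V : X → ℝ) (k : ℕ) {ν : ℝ} (hν : 0 < ν)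
    (hN : ∀ A : ℝ, 0 < A → ∀ u, N (A • u) = A ^ (k + 1) * N u)
    (hV : ∀ A : ℝ, 0 < A → ∀ u, V (A • u) = A ^ k * V u)
    (hN_odd : ∀ u, N (-u) = -N u) (hV_even : ∀ u, V (-u) = V u)
    (h : ∀ u, N u + ν * V u ≤ 0) : (∀ u, N u = 0) ∧ ∀ u, V u ≤ 0 := by
  have hs := parity_amplitude_sieve N (fun _ => 0) V (fun _ => 0) k hν hN
    (fun A hA u => by simp) hV (fun A hA u => by simp) hN_odd (fun _ => rfl) hV_even
    (fun _ => by simp) (fun u => by simpa using h u)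
  refine ⟨fun u => ?_, fun u => ?_⟩
  · have := (hs u).1
    simp only [neg_zero] at this
    exact abs_eq_zero.1 (le_antisymm this (abs_nonneg _))
  · have := (hs u).2
    simp only [abs_zero] at this
    linarith

/-! ## Sieve 2 with REAL amplitude degree (appended 2026-08-20; referee F3.2)

The dictionary has candidates of non-integer amplitude degree (`∫|ω|^{3/2}`, `∫|S|^{5/2}`, ratios,
roots: 41 of the 200 entries of `K0.json`). The same proofs with `Real.rpow` exponents. -/

/-- Core of the amplitude sieve, real exponent: if `c₁ A^{k+1} + c₂ A^k ≤ 0` for all `A > 0`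
(`k : ℝ`, real powers) then `c₁ ≤ 0` and `c₂ ≤ 0`. [folklore] -/
theorem coeff_nonpos_of_forall_mul_rpow_add_one_add_le {c₁ c₂ k : ℝ}
    (h : ∀ A : ℝ, 0 < A → c₁ * A ^ (k + 1) + c₂ * A ^ k ≤ 0) : c₁ ≤ 0 ∧ c₂ ≤ 0 := by
  have hlin : ∀ A : ℝ, 0 < A → c₁ * A + c₂ ≤ 0 := by
    intro A hA
    have hk : 0 < A ^ k := Real.rpow_pos_of_pos hA k
    have hA' := h A hA
    rw [Real.rpow_add_one hA.ne' k] at hA'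
    have hfac : c₁ * (A ^ k * A) + c₂ * A ^ k = A ^ k * (c₁ * A + c₂) := by ring
    rw [hfac] at hA'
    by_contra hcon
    have := mul_pos hk (not_le.mp hcon)
    linarith
  constructor
  · by_contra hc
    have hc' : 0 < c₁ := not_le.mp hc
    have := hlin ((|c₂| + 1) / c₁) (by positivity)
    rw [mul_div_cancel₀ _ hc'.ne'] at this
    linarith [neg_abs_le c₂]
  · by_contra hc
    have hc' : 0 < c₂ := not_le.mp hc
    have hA : 0 < c₂ / (2 * (|c₁| + 1)) := by positivity
    have := hlin _ hA
    have hc₁ : -|c₁| * (c₂ / (2 * (|c₁| + 1))) ≤ c₁ * (c₂ / (2 * (|c₁| + 1))) :=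
      mul_le_mul_of_nonneg_right (neg_abs_le c₁) hA.le
    have hkey : |c₁| * (c₂ / (2 * (|c₁| + 1))) < c₂ := by
      rw [mul_div_assoc', div_lt_iff₀ (by positivity)]
      nlinarith [abs_nonneg c₁]
    linarith

/-- **Amplitude sieve, real amplitude degree `k`.** As `amplitude_sieve` with `N (A • u) =
A^{k+1} N u`, `V (A • u) = A^k V u` for real `k` (real powers, `A > 0`). [folklore] -/
theorem amplitude_sieve_rpow {X : Type*} [AddCommGroup X] [Module ℝ X] (N V : X → ℝ) (k : ℝ)
    {ν : ℝ} (hν : 0 < ν)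
    (hN : ∀ A : ℝ, 0 < A → ∀ u, N (A • u) = A ^ (k + 1) * N u)
    (hV : ∀ A : ℝ, 0 < A → ∀ u, V (A • u) = A ^ k * V u)
    (h : ∀ u, N u + ν * V u ≤ 0) : (∀ u, N u ≤ 0) ∧ ∀ u, V u ≤ 0 := by
  have key : ∀ u, N u ≤ 0 ∧ ν * V u ≤ 0 := by
    intro u
    refine coeff_nonpos_of_forall_mul_rpow_add_one_add_le (k := k) fun A hA => ?_
    have := h (A • u)
    rw [hN A hA u, hV A hA u] at this
    linarith
  refine ⟨fun u => (key u).1, fun u => ?_⟩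
  by_contra hc
  have := mul_pos hν (not_le.mp hc)
  linarith [(key u).2]

/-- **Parity–amplitude sieve, real amplitude degree `k`.** As `parity_amplitude_sieve` with real
powers: `|Nₑ u| ≤ −Nₒ u` and `|Vₒ u| ≤ −Vₑ u` for every `u`. [folklore] -/
theorem parity_amplitude_sieve_rpow {X : Type*} [AddCommGroup X] [Module ℝ X]
    (Ne No Ve Vo : X → ℝ) (k : ℝ) {ν : ℝ} (hν : 0 < ν)
    (hNe : ∀ A : ℝ, 0 < A → ∀ u, Ne (A • u) = A ^ (k + 1) * Ne u)
    (hNo : ∀ A : ℝ, 0 < A → ∀ u, No (A • u) = A ^ (k + 1) * No u)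
    (hVe : ∀ A : ℝ, 0 < A → ∀ u, Ve (A • u) = A ^ k * Ve u)
    (hVo : ∀ A : ℝ, 0 < A → ∀ u, Vo (A • u) = A ^ k * Vo u)
    (hNe_odd : ∀ u, Ne (-u) = -Ne u) (hNo_even : ∀ u, No (-u) = No u)
    (hVe_even : ∀ u, Ve (-u) = Ve u) (hVo_odd : ∀ u, Vo (-u) = -Vo u)
    (h : ∀ u, Ne u + No u + ν * (Ve u + Vo u) ≤ 0) :
    ∀ u, |Ne u| ≤ -No u ∧ |Vo u| ≤ -Ve u := by
  have hs := amplitude_sieve_rpow (fun u => Ne u + No u) (fun u => Ve u + Vo u) k hν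
    (fun A hA u => by simp only [hNe A hA u, hNo A hA u]; ring)
    (fun A hA u => by simp only [hVe A hA u, hVo A hA u]; ring)
    (fun u => by simpa [mul_add, add_assoc] using h u)
  intro u
  have h1 := hs.1 u
  have h2 := hs.1 (-u)
  have h3 := hs.2 u
  have h4 := hs.2 (-u)
  simp only [hNe_odd, hNo_even, hVe_even, hVo_odd] at h2 h4
  constructor <;> rw [abs_le] <;> constructor <;> linarith

/-- **Even functionals of real amplitude degree: monotone ⇒ Euler-invariant.** [folklore] -/
theorem even_monotone_is_euler_invariant_rpow {X : Type*} [AddCommGroup X] [Module ℝ X]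
    (N V : X → ℝ) (k : ℝ) {ν : ℝ} (hν : 0 < ν)
    (hN : ∀ A : ℝ, 0 < A → ∀ u, N (A • u) = A ^ (k + 1) * N u)
    (hV : ∀ A : ℝ, 0 < A → ∀ u, V (A • u) = A ^ k * V u)
    (hN_odd : ∀ u, N (-u) = -N u) (hV_even : ∀ u, V (-u) = V u)
    (h : ∀ u, N u + ν * V u ≤ 0) : (∀ u, N u = 0) ∧ ∀ u, V u ≤ 0 := by
  have hs := parity_amplitude_sieve_rpow N (fun _ => 0) V (fun _ => 0) k hν hN
    (fun A hA u => by simp) hV (fun A hA u => by simp) hN_odd (fun _ => rfl) hV_even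
    (fun _ => by simp) (fun u => by simpa using h u)
  refine ⟨fun u => ?_, fun u => ?_⟩
  · have := (hs u).1
    simp only [neg_zero] at this
    exact abs_eq_zero.1 (le_antisymm this (abs_nonneg _))
  · have := (hs u).2
    simp only [abs_zero] at this
    linarith

end Summit.NavierStokesRegularity.FunctionalMining

end
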